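import Literature.AnabelianGeometry.SemiGraphs.CoveringGraphPullbackSndTwoCells
import HarnessLib

/-!
# [SemiAnbd] Prop 3.6 (iv)/(v), Prop 4.4 (i): pulling back along the second projection `ψ₀ : 𝒢'_{ψ^*S₀} → 𝒢_{S₀}`
# COMMUTES with the covering dictionary — the tower `𝒢''_{ψ₀^*T′} → 𝒢'_{ψ^*S₀} → H` IS the pull-back `𝒢'_{ψ^*S} → H` of ONE `S`

Mochizuki, *Semi-graphs of anabelioids*, Publ. RIMS **42** (2006), §2 p. 23 (for `G′ ∈ Ob(B(G))` the objects of
`B(𝒢′) = B(𝒢)_{𝒢′}` are the objects of `B(𝒢)` over `G′`), Prop 3.6 (iv) p. 39 («by pulling back … coverings of `𝒢` to …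
coverings of `𝒢′`»), Prop 3.6 (v) p. 39, Prop 4.4 (i) p. 54 («there exists a finite étale covering `K′ → K` … such that …
any connected component `H′` of the pull-back of this finite étale covering to `H` …»; print's `K′`, `H′` are written `K̃`,
`H̃` below) (kurims `paper:url-f33ace170ff4`). [cite: MochizukiSemiAnbd2006, Prop 4.4 (i), p. 54]

PROOF-ONLY (cell abc-iut, layer L3, seat abc-iut-f-161 gen 10, row «(2e) (b′) PASTING BRICK», L3-lead g9 GO ε22 13:36Z;
no definition, no instance, no notation, no named fact).  Setting: `ψ : H → K` with 2-cells `θ`, `S₀ ∈ B^cov(K)`, the fibre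
square `ψ₀ := ψ.covPullbackSnd θ S₀ : 𝒢'_{ψ^*S₀} → 𝒢_{S₀}` (abc-iut-f-161 g8) with its CANONICAL 2-cells `θ₀`
(`CoveringGraphPullbackSndTwoCells.lean`, hypothesis `hθ₀` below = «`θ₀` is that family»; it exists:
`Hom.exists_covPullbackSnd_conjugatorFamily`), and abc-iut-L3-d6's dictionary `toCovering : B^cov(G)_S ⥤ B^cov(𝒢_S)`.
* §4 the gluings: `toCovering_post_glue_val` (gluing of `toCovering (ψ^*U)` on points of `U` = translation by the aligned
  conjugator `ψ_{v′}(c′) θ_{b′}`), `covPullback_toCovering_glue_val` (gluing of `ψ₀^*(toCovering U)` = translation by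
  `θ₀_{β′} c`, any `θ₀`), `toCovering_post_covPullback_glue_comm` (maps of base-point fibres acting by the chosen translations
  `g_{ν′}`, `g_{ε′}` intertwine the two gluings — by the defining identity of the canonical `θ₀_{β′}`);
* §5 ★ `exists_toCovering_post_iso_covPullback_toCovering` — **`toCovering_{ψ^*S₀}(ψ^*U) ≅ ψ₀^*(toCovering_{S₀} U)`** in
  `B^cov(𝒢'_{ψ^*S₀})` for every `U → S₀`, acting on base-point fibres by `g_{ν′}` / `g_{ε′}`;
* §6 ★★ `nonempty_isoOver_covPullback_tower`, `nonempty_isoOver_pasting`, `exists_conjugatorFamily_pasting` — the PASTING: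
  for every `T′ ∈ B^cov(𝒢_{S₀})`, with `S := (pre T′).left` (abc-iut-L3-d6), `𝒢_{T′} → 𝒢_{S₀} → K ≅_K 𝒢_S → K` (abc-iut-f-161
  g9) AND `𝒢''_{ψ₀^*T′} → 𝒢'_{ψ^*S₀} → H ≅_H 𝒢'_{ψ^*S} → H` (abc-iut-L3-t3's `IsoOver`): two fibre squares compose to one;
  ★★★ `prop44i_onePullback_of_isQuasiCoherent` — abc-iut-f-161 g9's Prop 4.4 (i) (`prop44i_embedding_of_isQuasiCoherent`)
  at the canonical `θ₀`, with the components `H̃` now READ IN THE PULL-BACK `𝒢'_{ψ^*S} → H` OF ONE FINITE `K̃ = 𝒢_S → K`.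
HONEST LABELS: GENUINE at OUR typed profinite carriers; the displayed items of the NODES token that remain are (a) print's
hypotheses = finite objects of `Loc(𝔾, Γ)` (Prop 4.3 (i)) and (d) the `Loc` dressing — both SgA-side; «Prop 4.4 (i) proved
as printed» is NOT claimed.  For families of 2-cells of `ψ₀` other than the canonical one the iterated pull-back may differ
(d4-F3).  Nothing printed is asserted; no side taken on [IUTchIII] Cor. 3.12.
-/

noncomputable section

namespace Literature.AnabelianGeometry.SemiGraphs

open CategoryTheory
open Literature.AlgebraicGeometry.Frobenioids.QuasiTemperoid.BTempConnected (hom_ρ hom_ext_apply ρ_one_apply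
  ρ_mul_apply ρ_inv_apply)

universe u

namespace ProfiniteSemiGraph

/-! ## §4. The gluings of `toCovering (ψ^*U)` and of `ψ₀^*(toCovering U)` on points of `U` -/

namespace Hom

variable {H K : ProfiniteSemiGraph.{u}} (ψ : Hom H K) (θ : ψ.ConjugatorFamily) (S₀ : CovObj K)

/-- **The gluing of `toCovering (ψ^*U)` along a branch-orbit `β′ = (b′, ω) → ν′ = (v′, o)` of `𝒢'_{ψ^*S₀}`, on points of
`U`**: the gluing of `U` along `ψ b′`, then the 2-cell `θ_{b′}` of `ψ` (abc-iut-L3-d4's gluing of `ψ^*U`), then the incidence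
conjugator `c′` of `𝒢'_{ψ^*S₀}` acting through `ψ_{v′}` — i.e. translation by the aligned conjugator `ψ_{v′}(c′) θ_{b′}`.
[cite: MochizukiSemiAnbd2006, Prop 3.6(iv) p.39] -/
theorem toCovering_post_glue_val (U : Over S₀) {β' : ((ψ.covPullbackWith θ).obj S₀).coveringSemiGraph.Branch}
    {ν' : ((ψ.covPullbackWith θ).obj S₀).coveringSemiGraph.Vertex}
    (h' : ((ψ.covPullbackWith θ).obj S₀).coveringSemiGraph.abuts β' = some ν')
    (x : ((((ψ.covPullbackWith θ).obj S₀).toCovering.obj ((Over.post (ψ.covPullbackWith θ)).obj U)).SE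
      (((ψ.covPullbackWith θ).obj S₀).coveringSemiGraph.edgeOf β')).obj.V) :
    ((((((ψ.covPullbackWith θ).obj S₀).toCovering.obj ((Over.post (ψ.covPullbackWith θ)).obj U)).glue β' ν' h').hom.hom.hom
        x).1 : (U.left.SV (ψ.base.vertexMap ν'.1)).obj.V) =
      (U.left.SV (ψ.base.vertexMap ν'.1)).obj.ρ
        (ψ.hV ν'.1 (((ψ.covPullbackWith θ).obj S₀).conjugator h') *
          θ.θ β'.1 ν'.1 (((ψ.covPullbackWith θ).obj S₀).abuts_of_coveringAbuts h'))
        ((U.left.glue (ψ.base.branchMap β'.1) (ψ.base.vertexMap ν'.1)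
            (ψ.base.abuts_branchMap β'.1 ν'.1 (((ψ.covPullbackWith θ).obj S₀).abuts_of_coveringAbuts h'))).hom.hom.hom
          (U.left.castPtE (ψ.base.edgeOf_branchMap β'.1).symm x.1)) := by
  change (U.left.SV (ψ.base.vertexMap ν'.1)).obj.ρ (ψ.hV ν'.1 (((ψ.covPullbackWith θ).obj S₀).conjugator h'))
      ((((ψ.covPullbackWith θ).obj U.left).glue β'.1 ν'.1
        (((ψ.covPullbackWith θ).obj S₀).abuts_of_coveringAbuts h')).hom.hom.hom x.1) = _
  rw [covPullbackWith_glue_apply, U.left.eqRec_eq_castPtE (ψ.base.edgeOf_branchMap β'.1), ← ρ_mul_apply]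

/-- **The gluing of `ψ₀^*(toCovering U)` along `β′ → ν′`, on points of `U`** (any family of 2-cells `θ₀` of `ψ₀`): the
gluing of `U` along `ψ b′`, then the incidence conjugator `c` of `𝒢_{S₀}` at `ψ₀ β′` (abc-iut-L3-d6's gluing of
`toCovering U`), then the 2-cell `θ₀_{β′}` (abc-iut-L3-d4's gluing of the pull-back). [cite: MochizukiSemiAnbd2006, Prop 3.6(iv) p.39] -/
theorem covPullback_toCovering_glue_val (θ₀ : (ψ.covPullbackSnd θ S₀).ConjugatorFamily) (U : Over S₀)
    {β' : ((ψ.covPullbackWith θ).obj S₀).coveringSemiGraph.Branch}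
    {ν' : ((ψ.covPullbackWith θ).obj S₀).coveringSemiGraph.Vertex}
    (h' : ((ψ.covPullbackWith θ).obj S₀).coveringSemiGraph.abuts β' = some ν')
    (y : ((((ψ.covPullbackSnd θ S₀).covPullbackWith θ₀).obj (S₀.toCovering.obj U)).SE
      (((ψ.covPullbackWith θ).obj S₀).coveringSemiGraph.edgeOf β')).obj.V) :
    (((((ψ.covPullbackSnd θ S₀).covPullbackWith θ₀).obj (S₀.toCovering.obj U)).glue β' ν' h').hom.hom.hom y).1 =
      (U.left.SV ((ψ.covPullbackSnd θ S₀).base.vertexMap ν').1).obj.ρ (θ₀.θ β' ν' h').1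
        ((U.left.SV ((ψ.covPullbackSnd θ S₀).base.vertexMap ν').1).obj.ρ
          (S₀.conjugator ((ψ.covPullbackSnd θ S₀).base.abuts_branchMap β' ν' h'))
          ((U.left.glue ((ψ.covPullbackSnd θ S₀).base.branchMap β').1 ((ψ.covPullbackSnd θ S₀).base.vertexMap ν').1
              (S₀.abuts_of_coveringAbuts ((ψ.covPullbackSnd θ S₀).base.abuts_branchMap β' ν' h'))).hom.hom.hom
            (U.left.castPtE (congrArg Sigma.fst ((ψ.covPullbackSnd θ S₀).base.edgeOf_branchMap β')).symm y.1))) := by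
  rw [covPullbackWith_glue_apply, CovObj.toCovering_SV_ρ_val, CovObj.toCovering_glue_val,
    CovObj.toCovering_eqRec_val S₀ U ((ψ.covPullbackSnd θ S₀).base.edgeOf_branchMap β')]
  rfl

variable (θ₀ : (ψ.covPullbackSnd θ S₀).ConjugatorFamily)
  (hθ₀ : ∀ (β' : ((ψ.covPullbackWith θ).obj S₀).coveringSemiGraph.Branch)
    (ν' : ((ψ.covPullbackWith θ).obj S₀).coveringSemiGraph.Vertex)
    (h' : ((ψ.covPullbackWith θ).obj S₀).coveringSemiGraph.abuts β' = some ν'),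
    θ₀.θ β' ν' h' =
      ⟨_, CovObj.alignedTwoCell_mem_stab (((ψ.covPullbackWith θ).obj S₀).coveringHom.comp ψ) S₀
        (ψ.covPullbackPtV θ S₀) (ψ.covPullbackPtE θ S₀) (ψ.covPullback_glueCondition θ S₀) β' ν' h'
        ((ψ.covPullbackSnd θ S₀).base.abuts_branchMap β' ν' h')
        (ψ.hV ν'.1 (((ψ.covPullbackWith θ).obj S₀).conjugator h') *
          θ.θ β'.1 ν'.1 (((ψ.covPullbackWith θ).obj S₀).abuts_of_coveringAbuts h'))
        (ψ.covPullback_alignedConj_pt θ S₀ β' ν' h')⟩)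

include hθ₀ in
/-- **The gluings match.**  For `U → S₀` in `B^cov(K)`, a branch-orbit `β′ → ν′` of `𝒢'_{ψ^*S₀}`, and maps of base-point
fibres `f_V`, `f_E` ACTING BY abc-iut-L3-t3's chosen translations `g_{ν′}`, `g_{e(β′)}`: `f_E` then the gluing of
`ψ₀^*(toCovering U)` equals the gluing of `toCovering (ψ^*U)` then `f_V` — on points of `U` both are
`g_{ν′} ψ_{v′}(c′) θ_{b′} · glue_U(x) = θ₀_{β′} c (ψ b′)_*(g_{e(β′)}) · glue_U(x)` by the defining identity of the
CANONICAL 2-cell `θ₀_{β′}` (`hθ₀`). [cite: MochizukiSemiAnbd2006, Prop 3.6(iv) p.39] -/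
theorem toCovering_post_covPullback_glue_comm (U : Over S₀)
    (β' : ((ψ.covPullbackWith θ).obj S₀).coveringSemiGraph.Branch)
    (ν' : ((ψ.covPullbackWith θ).obj S₀).coveringSemiGraph.Vertex)
    (h' : ((ψ.covPullbackWith θ).obj S₀).coveringSemiGraph.abuts β' = some ν')
    (fV : (((ψ.covPullbackWith θ).obj S₀).toCovering.obj ((Over.post (ψ.covPullbackWith θ)).obj U)).SV ν' ⟶
      (((ψ.covPullbackSnd θ S₀).covPullbackWith θ₀).obj (S₀.toCovering.obj U)).SV ν')
    (hfV : ∀ t, (fV.hom.hom t).1 =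
      (U.left.SV ((ψ.covPullbackSnd θ S₀).base.vertexMap ν').1).obj.ρ
        (CovObj.gV (((ψ.covPullbackWith θ).obj S₀).coveringHom.comp ψ) S₀ (ψ.covPullbackPtV θ S₀) ν') t.1)
    (fE : (((ψ.covPullbackWith θ).obj S₀).toCovering.obj ((Over.post (ψ.covPullbackWith θ)).obj U)).SE
        (((ψ.covPullbackWith θ).obj S₀).coveringSemiGraph.edgeOf β') ⟶
      (((ψ.covPullbackSnd θ S₀).covPullbackWith θ₀).obj (S₀.toCovering.obj U)).SE
        (((ψ.covPullbackWith θ).obj S₀).coveringSemiGraph.edgeOf β'))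
    (hfE : ∀ t, (fE.hom.hom t).1 =
      (U.left.SE ((ψ.covPullbackSnd θ S₀).base.edgeMap (((ψ.covPullbackWith θ).obj S₀).coveringSemiGraph.edgeOf β')).1).obj.ρ
        (CovObj.gE (((ψ.covPullbackWith θ).obj S₀).coveringHom.comp ψ) S₀ (ψ.covPullbackPtE θ S₀)
          (((ψ.covPullbackWith θ).obj S₀).coveringSemiGraph.edgeOf β')) t.1) :
    fE ≫ ((((ψ.covPullbackSnd θ S₀).covPullbackWith θ₀).obj (S₀.toCovering.obj U)).glue β' ν' h').hom =
      ((((ψ.covPullbackWith θ).obj S₀).toCovering.obj ((Over.post (ψ.covPullbackWith θ)).obj U)).glue β' ν' h').hom ≫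
        (BTemp.res (((ψ.covPullbackWith θ).obj S₀).coveringGraph.brHom β' ν' h')).map fV := by
  apply hom_ext_apply
  intro x
  apply Subtype.ext
  change (((((ψ.covPullbackSnd θ S₀).covPullbackWith θ₀).obj (S₀.toCovering.obj U)).glue β' ν' h').hom.hom.hom
      (fE.hom.hom x)).1 =
    (fV.hom.hom (((((ψ.covPullbackWith θ).obj S₀).toCovering.obj ((Over.post (ψ.covPullbackWith θ)).obj U)).glue β' ν'
      h').hom.hom.hom x)).1
  rw [ψ.covPullback_toCovering_glue_val θ S₀ θ₀ U h', hfE, CovObj.castPtE_ρ, CovObj.glue_ρ, hfV,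
    ψ.toCovering_post_glue_val θ S₀ U h']
  exact BTemp.ρ_ρ_ρ_eq_of_eq_mul_inv _ (congrArg Subtype.val (hθ₀ β' ν' h')) _

/-! ## §5. ★ `toCovering (ψ^*U) ≅ ψ₀^*(toCovering U)` — objectwise, with its values on base-point fibres -/

include hθ₀ in
/-- ★ **Pulling back along the second projection commutes with the covering dictionary, objectwise.**  For the CANONICAL
2-cells `θ₀` of `ψ₀ : 𝒢'_{ψ^*S₀} → 𝒢_{S₀}` and every `U → S₀` in `B^cov(K)`: the object of `B^cov(𝒢'_{ψ^*S₀})` attached by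
abc-iut-L3-d6's dictionary `B^cov(H)_{ψ^*S₀} ⥤ B^cov(𝒢'_{ψ^*S₀})` to `ψ^*U → ψ^*S₀` IS the pull-back along `ψ₀` of the object
`toCovering U ∈ B^cov(𝒢_{S₀})` — by an isomorphism acting on base-point fibres by abc-iut-L3-t3's chosen translations
`g_{ν′}` (vertices), `g_{ε′}` (edges) into the base points.  (§2 p.23: the finite étale coverings of `𝒢′ ∈ B(𝒢)` are the
objects of `B(𝒢)` over `G′`; here for the pull-back square of Prop 3.6 (iv).) [cite: MochizukiSemiAnbd2006, Prop 3.6(iv) p.39] -/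
theorem exists_toCovering_post_iso_covPullback_toCovering (U : Over S₀) :
    ∃ e : ((ψ.covPullbackWith θ).obj S₀).toCovering.obj ((Over.post (ψ.covPullbackWith θ)).obj U) ≅
        ((ψ.covPullbackSnd θ S₀).covPullbackWith θ₀).obj (S₀.toCovering.obj U),
      (∀ (ν' : ((ψ.covPullbackWith θ).obj S₀).coveringSemiGraph.Vertex) (t : _),
        ((e.hom.fV ν').hom.hom t).1 =
          (U.left.SV ((ψ.covPullbackSnd θ S₀).base.vertexMap ν').1).obj.ρ
            (CovObj.gV (((ψ.covPullbackWith θ).obj S₀).coveringHom.comp ψ) S₀ (ψ.covPullbackPtV θ S₀) ν') t.1) ∧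
      ∀ (ε' : ((ψ.covPullbackWith θ).obj S₀).coveringSemiGraph.Edge) (t : _),
        ((e.hom.fE ε').hom.hom t).1 =
          (U.left.SE ((ψ.covPullbackSnd θ S₀).base.edgeMap ε').1).obj.ρ
            (CovObj.gE (((ψ.covPullbackWith θ).obj S₀).coveringHom.comp ψ) S₀ (ψ.covPullbackPtE θ S₀) ε') t.1 := by
  have hV : ∀ ν' : ((ψ.covPullbackWith θ).obj S₀).coveringSemiGraph.Vertex,
      ∃ e : (((ψ.covPullbackWith θ).obj S₀).toCovering.obj ((Over.post (ψ.covPullbackWith θ)).obj U)).SV ν' ≅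
          (((ψ.covPullbackSnd θ S₀).covPullbackWith θ₀).obj (S₀.toCovering.obj U)).SV ν',
        (∀ t, (e.hom.hom.hom t).1 =
          (U.left.SV ((ψ.covPullbackSnd θ S₀).base.vertexMap ν').1).obj.ρ
            (CovObj.gV (((ψ.covPullbackWith θ).obj S₀).coveringHom.comp ψ) S₀ (ψ.covPullbackPtV θ S₀) ν') t.1) ∧
        ∀ t, (e.inv.hom.hom t).1 =
          (U.left.SV ((ψ.covPullbackSnd θ S₀).base.vertexMap ν').1).obj.ρ
            (CovObj.gV (((ψ.covPullbackWith θ).obj S₀).coveringHom.comp ψ) S₀ (ψ.covPullbackPtV θ S₀) ν')⁻¹ t.1 :=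
    fun ν' => BTemp.exists_ptFibre_post_res_iso (ψ.hV ν'.1) (S₀.SV (ψ.base.vertexMap ν'.1))
      ((S₀.postV (ψ.base.vertexMap ν'.1)).obj U) (Quot.out ν'.2)
      (Quot.out (BTemp.cl (S₀.SV _) (ψ.covPullbackPtV θ S₀ ν')))
      (CovObj.gV (((ψ.covPullbackWith θ).obj S₀).coveringHom.comp ψ) S₀ (ψ.covPullbackPtV θ S₀) ν')
      (CovObj.gV_spec (((ψ.covPullbackWith θ).obj S₀).coveringHom.comp ψ) S₀ (ψ.covPullbackPtV θ S₀) ν')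
      ((((ψ.covPullbackWith θ).obj S₀).coveringHom.comp ψ).hV ν') (fun _ => rfl)
      (fun h => CovObj.conj_mem_stab _ _ _
        (CovObj.gV_spec (((ψ.covPullbackWith θ).obj S₀).coveringHom.comp ψ) S₀ (ψ.covPullbackPtV θ S₀) ν')
        ((ψ.covPullback_stabLE θ S₀).mem_hV ν' h))
  have hE : ∀ ε' : ((ψ.covPullbackWith θ).obj S₀).coveringSemiGraph.Edge,
      ∃ e : (((ψ.covPullbackWith θ).obj S₀).toCovering.obj ((Over.post (ψ.covPullbackWith θ)).obj U)).SE ε' ≅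
          (((ψ.covPullbackSnd θ S₀).covPullbackWith θ₀).obj (S₀.toCovering.obj U)).SE ε',
        (∀ t, (e.hom.hom.hom t).1 =
          (U.left.SE ((ψ.covPullbackSnd θ S₀).base.edgeMap ε').1).obj.ρ
            (CovObj.gE (((ψ.covPullbackWith θ).obj S₀).coveringHom.comp ψ) S₀ (ψ.covPullbackPtE θ S₀) ε') t.1) ∧
        ∀ t, (e.inv.hom.hom t).1 =
          (U.left.SE ((ψ.covPullbackSnd θ S₀).base.edgeMap ε').1).obj.ρ
            (CovObj.gE (((ψ.covPullbackWith θ).obj S₀).coveringHom.comp ψ) S₀ (ψ.covPullbackPtE θ S₀) ε')⁻¹ t.1 :=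
    fun ε' => BTemp.exists_ptFibre_post_res_iso (ψ.hE ε'.1) (S₀.SE (ψ.base.edgeMap ε'.1))
      ((S₀.postE (ψ.base.edgeMap ε'.1)).obj U) (Quot.out ε'.2)
      (Quot.out (BTemp.cl (S₀.SE _) (ψ.covPullbackPtE θ S₀ ε')))
      (CovObj.gE (((ψ.covPullbackWith θ).obj S₀).coveringHom.comp ψ) S₀ (ψ.covPullbackPtE θ S₀) ε')
      (CovObj.gE_spec (((ψ.covPullbackWith θ).obj S₀).coveringHom.comp ψ) S₀ (ψ.covPullbackPtE θ S₀) ε')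
      ((((ψ.covPullbackWith θ).obj S₀).coveringHom.comp ψ).hE ε') (fun _ => rfl)
      (fun h => CovObj.conj_mem_stab _ _ _
        (CovObj.gE_spec (((ψ.covPullbackWith θ).obj S₀).coveringHom.comp ψ) S₀ (ψ.covPullbackPtE θ S₀) ε')
        ((ψ.covPullback_stabLE θ S₀).mem_hE ε' h))
  choose eV heV heV' using hV
  choose eE heE heE' using hE
  have hcomm : ∀ (β' : ((ψ.covPullbackWith θ).obj S₀).coveringSemiGraph.Branch)
      (ν' : ((ψ.covPullbackWith θ).obj S₀).coveringSemiGraph.Vertex)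
      (h' : ((ψ.covPullbackWith θ).obj S₀).coveringSemiGraph.abuts β' = some ν'),
      (eE (((ψ.covPullbackWith θ).obj S₀).coveringSemiGraph.edgeOf β')).hom ≫
          ((((ψ.covPullbackSnd θ S₀).covPullbackWith θ₀).obj (S₀.toCovering.obj U)).glue β' ν' h').hom =
        ((((ψ.covPullbackWith θ).obj S₀).toCovering.obj ((Over.post (ψ.covPullbackWith θ)).obj U)).glue β' ν' h').hom ≫
          (BTemp.res (((ψ.covPullbackWith θ).obj S₀).coveringGraph.brHom β' ν' h')).map (eV ν').hom :=
    fun β' ν' h' => ψ.toCovering_post_covPullback_glue_comm θ S₀ θ₀ hθ₀ U β' ν' h' (eV ν').hom (heV ν')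
      (eE _).hom (heE _)
  refine ⟨{ hom := ⟨fun ν' => (eV ν').hom, fun ε' => (eE ε').hom, hcomm⟩
            inv := ⟨fun ν' => (eV ν').inv, fun ε' => (eE ε').inv, fun β' ν' h' => ?_⟩
            hom_inv_id := ?_
            inv_hom_id := ?_ }, fun ν' t => heV ν' t, fun ε' t => heE ε' t⟩
  · rw [Iso.inv_comp_eq, ← Category.assoc, hcomm β' ν' h', Category.assoc, ← (BTemp.res _).map_comp, Iso.hom_inv_id,
      CategoryTheory.Functor.map_id, Category.comp_id]
  · refine CovHom.ext ?_ ?_ <;> funext c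
    · exact (eV c).hom_inv_id
    · exact (eE c).hom_inv_id
  · refine CovHom.ext ?_ ?_ <;> funext c
    · exact (eV c).inv_hom_id
    · exact (eE c).inv_hom_id

/-! ## §6. ★★ PASTING: the tower `𝒢''_{ψ₀^*T′} → 𝒢'_{ψ^*S₀} → H` IS the pull-back `𝒢'_{ψ^*S} → H` of ONE `S ∈ B^cov(K)` -/

include hθ₀ in
/-- ★★ **Two fibre squares compose to one (over `U → S₀`).**  For the CANONICAL 2-cells `θ₀` of `ψ₀` and `U → S₀` in
`B^cov(K)`: the TOWER `𝒢''_{ψ₀^*(toCovering U)} → 𝒢'_{ψ^*S₀} → H` — abc-iut-f-161's second projection `ψ₀` of the fibre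
square of `S₀` along `ψ`, then the fibre square of `toCovering U` along `ψ₀` — is isomorphic OVER `H` (abc-iut-L3-t3's
`Hom.IsoOver`) to the covering `𝒢'_{ψ^*U} → H` of the pull-back of the total object `U`: §5 then abc-iut-f-161 g9's
`CovObj.nonempty_isoOver_tower` over `H`. [cite: MochizukiSemiAnbd2006, Prop 3.6(iv) p.39] -/
theorem nonempty_isoOver_covPullback_tower (U : Over S₀) :
    Nonempty (Hom.IsoOver
      ((((ψ.covPullbackSnd θ S₀).covPullbackWith θ₀).obj (S₀.toCovering.obj U)).coveringHom.comp
        ((ψ.covPullbackWith θ).obj S₀).coveringHom)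
      ((ψ.covPullbackWith θ).obj U.left).coveringHom) := by
  obtain ⟨e, -, -⟩ := ψ.exists_toCovering_post_iso_covPullback_toCovering θ S₀ θ₀ hθ₀ U
  exact ((ψ.covPullbackWith θ).obj S₀).nonempty_isoOver_tower ((Over.post (ψ.covPullbackWith θ)).obj U) e

include hθ₀ in
/-- ★★ **PASTING, for an arbitrary covering `T′ ∈ B^cov(𝒢_{S₀})` of the covering.**  With `S := (pre T′).left ∈ B^cov(K)`
(abc-iut-L3-d6's essential preimage under `B^cov(K)_{S₀} ≌ B^cov(𝒢_{S₀})`): the tower `𝒢_{T′} → 𝒢_{S₀} → K` is `𝒢_S → K`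
over `K` (abc-iut-f-161 g9) AND its pull-back tower `𝒢''_{ψ₀^*T′} → 𝒢'_{ψ^*S₀} → H` along the fibre square is
`𝒢'_{ψ^*S} → H` over `H` — print's «pull-back of this finite étale covering to `H`» (Prop 4.4 (i)) read through the two
squares is the pull-back of ONE covering of `K`.  `θ₀` = the CANONICAL 2-cells of `ψ₀` (`hθ₀`); for other families of
2-cells of `ψ₀` the iterated pull-back may differ (cell finding d4-F3). [cite: MochizukiSemiAnbd2006, Prop 4.4 (i), p. 54] -/
theorem nonempty_isoOver_pasting (T' : CovObj S₀.coveringGraph) :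
    Nonempty (Hom.IsoOver (T'.coveringHom.comp S₀.coveringHom) (S₀.pre T').left.coveringHom) ∧
      Nonempty (Hom.IsoOver
        ((((ψ.covPullbackSnd θ S₀).covPullbackWith θ₀).obj T').coveringHom.comp ((ψ.covPullbackWith θ).obj S₀).coveringHom)
        ((ψ.covPullbackWith θ).obj (S₀.pre T').left).coveringHom) := by
  obtain ⟨e, -, -⟩ := ψ.exists_toCovering_post_iso_covPullback_toCovering θ S₀ θ₀ hθ₀ (S₀.pre T')
  exact ⟨S₀.nonempty_isoOver_tower (S₀.pre T') (S₀.preIso T'),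
    ((ψ.covPullbackWith θ).obj S₀).nonempty_isoOver_tower ((Over.post (ψ.covPullbackWith θ)).obj (S₀.pre T'))
      (e ≪≫ ((ψ.covPullbackSnd θ S₀).covPullbackWith θ₀).mapIso (S₀.preIso T'))⟩

omit θ₀ hθ₀ in
/-- ★★ **PASTING (binder-free form): there is a family of 2-cells of the second projection `ψ₀ : 𝒢'_{ψ^*S₀} → 𝒢_{S₀}`
— the canonical one of §2 — under which, for EVERY `T′ ∈ B^cov(𝒢_{S₀})`, the pulled-back tower over `H` is the pull-back
`𝒢'_{ψ^*S} → H` of the ONE object `S := (pre T′).left ∈ B^cov(K)` realising the tower `𝒢_{T′} → 𝒢_{S₀} → K` over `K`**;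
`S` is finite when `S₀` and `T′` are (abc-iut-L3-t5). [cite: MochizukiSemiAnbd2006, Prop 4.4 (i), p. 54] -/
theorem exists_conjugatorFamily_pasting :
    ∃ θ₀ : (ψ.covPullbackSnd θ S₀).ConjugatorFamily, ∀ T' : CovObj S₀.coveringGraph,
      Nonempty (Hom.IsoOver (T'.coveringHom.comp S₀.coveringHom) (S₀.pre T').left.coveringHom) ∧
      Nonempty (Hom.IsoOver
        ((((ψ.covPullbackSnd θ S₀).covPullbackWith θ₀).obj T').coveringHom.comp ((ψ.covPullbackWith θ).obj S₀).coveringHom)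
        ((ψ.covPullbackWith θ).obj (S₀.pre T').left).coveringHom) ∧
      (S₀.IsFinite → T'.IsFinite → (S₀.pre T').left.IsFinite) := by
  obtain ⟨θ₀, hθ₀⟩ := ψ.exists_covPullbackSnd_conjugatorFamily θ S₀
  exact ⟨θ₀, fun T' => ⟨(ψ.nonempty_isoOver_pasting θ S₀ θ₀ hθ₀ T').1, (ψ.nonempty_isoOver_pasting θ S₀ θ₀ hθ₀ T').2,
    fun h₀ h' => S₀.isFinite_pre h₀ T' h'⟩⟩

omit θ₀ hθ₀ in
/-- ★★★ **Prop 4.4 (i), GENUINE at the profinite carriers, with the components READ IN THE PULL-BACK OF ONE FINITE ÉTALE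
COVERING `K̃ = 𝒢_S → K`** (print: «there exists a finite étale covering `K′ → K` … such that … any connected component `H′`
of the pull-back of this finite étale covering to `H` …»; print's `K′`, `H′` written `K̃`, `H̃`).  For `ψ : H → K` with
`𝔾_H`, `𝔾_K` finite, `H` totally aloof, `K` quasi-coherent, `ψ` locally open with injective constituents (abc-iut-f-161 g9's
`prop44i_embedding_of_isQuasiCoherent`, AT the canonical 2-cells `θ₀` of `ψ₀`): a finite tempered `S₀ ∈ B^cov(K)`, a
finite graph-covering `π : B′ → 𝔾_{S₀}`, and ONE FINITE `S ∈ B^cov(K)` with `𝒢_{S_π} → 𝒢_{S₀} → K ≅_K 𝒢_S → K` AND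
`𝒢''_{ψ₀^*S_π} → 𝒢'_{ψ^*S₀} → H ≅_H 𝒢'_{ψ^*S} → H`, such that `𝒢''_{ψ₀^*S_π} → 𝒢_{S_π}` is LOCALLY TRIVIAL and an EMBEDDING on
every connected sub-semi-graph of `𝔾''_{ψ₀^*S_π}` — the connected components `H̃` of the pull-back `𝒢'_{ψ^*S}` of
`K̃ = 𝒢_S` to `H` embed.  Displayed (unchanged): print's hypotheses are the finite objects of `Loc(𝔾, Γ)` (Prop 4.3 (i));
no `Loc` dressing; the isomorphisms over `H`, `K` are abc-iut-L3-t3's `IsoOver` (compatible with the structure morphisms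
up to inner automorphisms). [cite: MochizukiSemiAnbd2006, Prop 4.4 (i), p. 54] -/
theorem prop44i_onePullback_of_isQuasiCoherent (hH : H.graph.IsFinite) (hK : K.graph.IsFinite) (hHa : H.IsTotallyAloof)
    (hqc : K.IsQuasiCoherent) (hψ : ψ.IsLocallyOpen)
    (hinjV : ∀ w, Function.Injective (ψ.hV w)) (hinjE : ∀ e', Function.Injective (ψ.hE e')) :
    ∃ S₀ : CovObj K, S₀.IsFinite ∧ S₀.HasNonemptyFibres ∧ S₀.IsTempered ∧
      (ψ.covPullbackSnd θ S₀).IsLocallyTrivial ∧ SemiGraph.IsImmersion (ψ.covPullbackSnd θ S₀).base ∧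
      ∃ (θ₀ : (ψ.covPullbackSnd θ S₀).ConjugatorFamily)
        (B' : SemiGraph.{u}) (π : B' ⟶ S₀.coveringGraph.graph) (hπ : SemiGraph.IsExcision π) (hp : SemiGraph.IsProper π)
        (_ : ∀ v, Countable (SemiGraph.Hom.VertexFiber π v)) (_ : ∀ e, Countable (SemiGraph.Hom.EdgeFiber π e)),
        B'.IsFinite ∧ SemiGraph.IsFiniteGraphCovering π ∧
        (CovObj.ofSemiGraphCovering π hπ hp).IsFinite ∧ (CovObj.ofSemiGraphCovering π hπ hp).IsLocallyTrivial ∧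
        ((ψ.covPullbackSnd θ S₀).covPullbackSnd θ₀ (CovObj.ofSemiGraphCovering π hπ hp)).IsLocallyTrivial ∧
        (∀ C : ((((ψ.covPullbackSnd θ S₀).covPullbackWith θ₀).obj (CovObj.ofSemiGraphCovering π hπ hp)).coveringSemiGraph).Subgraph,
          C.toSemiGraph.IsConnected →
            SemiGraph.IsEmbedding (C.ι ≫ ((ψ.covPullbackSnd θ S₀).covPullbackSnd θ₀ (CovObj.ofSemiGraphCovering π hπ hp)).base)) ∧
        ∃ S : CovObj K, S.IsFinite ∧
          Nonempty (Hom.IsoOver ((CovObj.ofSemiGraphCovering π hπ hp).coveringHom.comp S₀.coveringHom) S.coveringHom) ∧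
          Nonempty (Hom.IsoOver
            ((((ψ.covPullbackSnd θ S₀).covPullbackWith θ₀).obj (CovObj.ofSemiGraphCovering π hπ hp)).coveringHom.comp
              ((ψ.covPullbackWith θ).obj S₀).coveringHom)
            ((ψ.covPullbackWith θ).obj S).coveringHom) := by
  obtain ⟨S₀, hfin, hne, htemp, hlt, himm, hrest⟩ := ψ.prop44i_embedding_of_isQuasiCoherent θ hH hK hHa hqc hψ hinjV hinjE
  obtain ⟨θ₀, hθ₀⟩ := ψ.exists_conjugatorFamily_pasting θ S₀
  refine ⟨S₀, hfin, hne, htemp, hlt, himm, θ₀, ?_⟩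
  obtain ⟨B', π, hπ, hp, hcV, hcE, hB', hfgc, hfin₁, hlt₁, hlt₂, hemb⟩ := hrest θ₀
  obtain ⟨hK', hH', hSfin⟩ := hθ₀ (CovObj.ofSemiGraphCovering π hπ hp)
  exact ⟨B', π, hπ, hp, hcV, hcE, hB', hfgc, hfin₁, hlt₁, hlt₂, hemb, (S₀.pre (CovObj.ofSemiGraphCovering π hπ hp)).left,
    hSfin hfin hfin₁, hK', hH'⟩

end Hom

end ProfiniteSemiGraph

end Literature.AnabelianGeometry.SemiGraphs

end
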